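import Mathlib
import Summits.CriticalPhenomena.CardyFormulaZ2.Theorems.CardyMagicRigidityDefs
import Literature.Probability.Percolation.FullPlaneCNL
import Literature.Probability.Percolation.LoopRepresentationProofs
import Literature.Probability.Percolation.SiteNestingWeightBound
import Literature.Probability.Percolation.FKLoopNestingIntegrable
import HarnessLib

/-!
# Soft machine, brick 7: measurability of the closeness events `{d_CN(lattice, X s) ≤ ε}`

Crux `Summit.CriticalPhenomena.CardyFormulaZ2.Theses.CardyMagicRigidity.NestingRigidity`
(stmt-CriticalPhenomena-4835), line `positive-cone-weight-doubling`, registered stub `stub_tamePrecompactness`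
(SOFT MACHINE, T1m shape: MEASURABLE closeness events).  The generic machine (`softMachine_limit`, brick 6)
delivers limit presentations `X : [0,1] → C` with measurable HITTING events `{s | ∃ u ∈ (X s).F i, u ∈ Q}`,
`Q` closed.  This file shows that this intrinsic property is all that the closeness events need:

* `SoftMachine.measurableSet_isClose_of_hit` — for a COUNTABLY GENERATED random configuration `Y` (as every lattice
  loop representation: `(Y ω).F i = {f i k | ω ∈ S i k}`, measurable `S i k`, countable `k`) which is WINDOW-FINITE
  (finitely many loops of `Y ω` inside any disc) and any `X` with measurable hitting events, the event
  `{(ω, t) | d_CN(Y ω, X t) ≤ ε}` (`LoopConfig.IsClose ε`) is measurable on `Ω × T`.  The first half of `IsClose`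
  is a countable conjunction over the generators; the second ("every loop of `X t` in the window has an `ε`-partner
  in `Y ω`") is decomposed along the FINITE set of loops of `Y ω` inside `B(0, 1/ε + ε)` (where all partners live,
  `UnbasedLoop.range_subset_ball_of_udist_le`), a countably-valued measurable function of `ω`, each piece being
  the complement of a hitting event of an OPEN set of unbased loops.
* `softMachine_measurableSet_isClose_latticeEnsembles` (registered anchor) — hence, for both lattice ensembles
  `E' ∈ {zEns, tEns}` at every mesh `δ > 0` (`gen_bondLoopConfig`, `gen_siteLoopConfig`; window-finiteness
  `ncard_loops_meeting_le`, `ncard_loops_siteLoopConfig_meeting_le`), the closeness events against any such `X`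
  are measurable.
-/

noncomputable section

open MeasureTheory Set Filter Metric TopologicalSpace Function
open scoped Topology ENNReal NNReal

namespace Summit.CriticalPhenomena.CardyFormulaZ2.Cruxes.NestingRigidity.PositiveConeWeightDoubling

open Literature.Probability.RandomPlanarGeometry Literature.Probability.Percolation
  Literature.Probability.LatticeModels
open Summit.CriticalPhenomena.CardyFormulaZ2.Cruxes.NestingRigidity.RingCloudTomography

namespace SoftMachine

/-! ### Topology of unbased loops -/

/-- `udist u ·` is continuous (minimum of two distances, reversal being an isometry). -/
theorem continuous_udist_right (u : UnbasedLoop ℂ) : Continuous fun v ↦ u.udist v := by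
  have hrev : Isometry (UnbasedLoop.reverse : UnbasedLoop ℂ → UnbasedLoop ℂ) :=
    Isometry.of_dist_eq fun a b ↦ UnbasedLoop.dist_reverse_reverse a b
  change Continuous fun v ↦ min (dist u v) (dist u v.reverse)
  exact (continuous_const.dist continuous_id).min (continuous_const.dist hrev.continuous)

/-- `udist · u` is continuous. -/
theorem continuous_udist_left (u : UnbasedLoop ℂ) : Continuous fun v : UnbasedLoop ℂ ↦ v.udist u := by
  have h : (fun v : UnbasedLoop ℂ ↦ v.udist u) = fun v ↦ u.udist v := funext fun v ↦ UnbasedLoop.udist_comm v u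
  rw [h]
  exact continuous_udist_right u

/-- A constant condition defines a measurable set. -/
theorem measurableSet_setOf_const {α : Type*} [MeasurableSpace α] (p : Prop) : MeasurableSet {_a : α | p} := by
  by_cases hp : p
  · simp only [hp, setOf_true]; exact MeasurableSet.univ
  · simp only [hp, setOf_false]; exact MeasurableSet.empty

/-- The unbased loops with trace inside an open set form an open set (traces are compact and move by at most the
distance, `UnbasedLoop.infDist_range_le_dist`). -/
theorem isOpen_setOf_unbased_range_subset {U : Set ℂ} (hU : IsOpen U) : IsOpen {v : UnbasedLoop ℂ | v.range ⊆ U} := by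
  rw [Metric.isOpen_iff]
  intro v hv
  obtain ⟨r, hr, hrU⟩ := v.isCompact_range.exists_cthickening_subset_open hU hv
  refine ⟨r, hr, fun w hw x hx ↦ hrU ?_⟩
  rw [mem_ball] at hw
  have h := (UnbasedLoop.infDist_range_le_dist w v hx).trans_lt hw
  exact thickening_subset_cthickening r _ ((mem_thickening_iff_infDist_lt v.range_nonempty).2 h)

/-! ### Measurability of the closeness events -/

variable {Ω T : Type*} [MeasurableSpace Ω] [MeasurableSpace T]

/-- Measurable hitting events of closed sets give measurable hitting events of open sets. -/
theorem measurableSet_hit_of_isOpen {X : T → LoopConfig ℂ}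
    (hX : ∀ (i : Fin 2) (Q : Set (UnbasedLoop ℂ)), IsClosed Q → MeasurableSet {t | ∃ u ∈ (X t).F i, u ∈ Q})
    (i : Fin 2) {U : Set (UnbasedLoop ℂ)} (hU : IsOpen U) : MeasurableSet {t | ∃ u ∈ (X t).F i, u ∈ U} := by
  obtain ⟨C, hCc, -, hCU, -⟩ := hU.exists_iUnion_isClosed
  have hset : {t | ∃ u ∈ (X t).F i, u ∈ U} = ⋃ n, {t | ∃ u ∈ (X t).F i, u ∈ C n} := by
    ext t
    simp only [mem_setOf_eq, mem_iUnion, ← hCU]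
    exact ⟨fun ⟨u, hu, n, hn⟩ ↦ ⟨n, u, hu, hn⟩, fun ⟨n, u, hu, hn⟩ ↦ ⟨u, hu, n, hn⟩⟩
  rw [hset]
  exact MeasurableSet.iUnion fun n ↦ hX i (C n) (hCc n)

/-- **Measurability of `{d_CN(Y ω, X t) ≤ ε}`** for a countably generated, window-finite random configuration `Y`
and a random configuration `X` with measurable hitting events (see the module docstring). -/
theorem measurableSet_isClose_of_hit {ι : Type*} [Countable ι] (Y : Ω → LoopConfig ℂ) (X : T → LoopConfig ℂ)
    (f : Fin 2 → ι → UnbasedLoop ℂ) (S : Fin 2 → ι → Set Ω) (hS : ∀ i k, MeasurableSet (S i k))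
    (hY : ∀ ω i u, u ∈ (Y ω).F i ↔ ∃ k, ω ∈ S i k ∧ f i k = u)
    (hfinY : ∀ ω i (R : ℝ), {u ∈ (Y ω).F i | u.range ⊆ ball (0 : ℂ) R}.Finite)
    (hX : ∀ (i : Fin 2) (Q : Set (UnbasedLoop ℂ)), IsClosed Q → MeasurableSet {t | ∃ u ∈ (X t).F i, u ∈ Q})
    (ε : ℝ) : MeasurableSet {p : Ω × T | LoopConfig.IsClose ε (Y p.1) (X p.2)} := by
  classical
  rcases le_or_gt ε 0 with hε | hε
  · -- the window `B(0, 1/ε)` is empty: every pair is `ε`-close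
    have hball : ball (0 : ℂ) (1 / ε) = ∅ := by
      rw [Metric.ball_eq_empty]
      rcases hε.lt_or_eq with h | h
      · exact (one_div_neg.2 h).le
      · rw [h, div_zero]
    have huniv : {p : Ω × T | LoopConfig.IsClose ε (Y p.1) (X p.2)} = univ := by
      refine eq_univ_of_forall fun p i ↦ ⟨fun u _ hr ↦ ?_, fun u _ hr ↦ ?_⟩ <;>
      · rw [hball, subset_empty_iff] at hr
        exact absurd hr u.range_nonempty.ne_empty
    rw [huniv]
    exact MeasurableSet.univ
  -- membership in `Y ω` is measurable
  have hmem : ∀ i (u : UnbasedLoop ℂ), MeasurableSet {ω | u ∈ (Y ω).F i} := by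
    intro i u
    have : {ω | u ∈ (Y ω).F i} = ⋃ k ∈ {k | f i k = u}, S i k := by
      ext ω; simp only [mem_setOf_eq, hY, mem_iUnion, exists_prop]; tauto
    rw [this]
    exact MeasurableSet.biUnion (Set.to_countable _) fun k _ ↦ hS i k
  -- the two halves of `IsClose`, type by type
  have hsplit : {p : Ω × T | LoopConfig.IsClose ε (Y p.1) (X p.2)} = ⋂ i : Fin 2,
      ({p | ∀ u ∈ (Y p.1).F i, u.range ⊆ ball (0 : ℂ) (1 / ε) → ∃ u' ∈ (X p.2).F i, u.udist u' ≤ ε} ∩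
       {p | ∀ u' ∈ (X p.2).F i, u'.range ⊆ ball (0 : ℂ) (1 / ε) → ∃ u ∈ (Y p.1).F i, u'.udist u ≤ ε}) := by
    ext p; simp only [LoopConfig.IsClose, mem_setOf_eq, mem_iInter, mem_inter_iff]
  rw [hsplit]
  refine MeasurableSet.iInter fun i ↦ MeasurableSet.inter ?_ ?_
  · -- first half: countable conjunction over the generators
    have hA : {p : Ω × T | ∀ u ∈ (Y p.1).F i, u.range ⊆ ball (0 : ℂ) (1 / ε) → ∃ u' ∈ (X p.2).F i, u.udist u' ≤ ε}
        = ⋂ k : ι, ((S i k)ᶜ ×ˢ univ ∪ {p | ¬ (f i k).range ⊆ ball (0 : ℂ) (1 / ε)} ∪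
            univ ×ˢ {t | ∃ u' ∈ (X t).F i, u' ∈ {u' | (f i k).udist u' ≤ ε}}) := by
      ext p
      simp only [mem_setOf_eq, mem_iInter, mem_union, mem_prod, mem_compl_iff, mem_univ, and_true, true_and]
      constructor
      · intro h k
        by_cases hk : p.1 ∈ S i k
        · by_cases hr : (f i k).range ⊆ ball (0 : ℂ) (1 / ε)
          · exact Or.inr (h (f i k) ((hY p.1 i _).2 ⟨k, hk, rfl⟩) hr)
          · exact Or.inl (Or.inr hr)
        · exact Or.inl (Or.inl hk)
      · intro h u hu hr
        obtain ⟨k, hk, rfl⟩ := (hY p.1 i u).1 hu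
        rcases h k with (hk' | hr') | h'
        · exact absurd hk hk'
        · exact absurd hr hr'
        · exact h'
    rw [hA]
    exact MeasurableSet.iInter fun k ↦ ((((hS i k).compl.prod MeasurableSet.univ).union
      (measurableSet_setOf_const _)).union
      (MeasurableSet.univ.prod (hX i _ (isClosed_le (continuous_udist_right (f i k)) continuous_const))))
  · -- second half: decompose along the finite set of loops of `Y ω` inside `B(0, 1/ε + ε)`
    set L₀ : Set (UnbasedLoop ℂ) := Set.range (f i) with hL₀
    have hL₀c : L₀.Countable := Set.countable_range _
    set 𝒜 : Set (Set (UnbasedLoop ℂ)) := {A | A.Finite ∧ A ⊆ L₀} with h𝒜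
    have h𝒜c : 𝒜.Countable := Set.countable_setOf_finite_subset hL₀c
    set Uw : Ω → Set (UnbasedLoop ℂ) := fun ω ↦ {u ∈ (Y ω).F i | u.range ⊆ ball (0 : ℂ) (1 / ε + ε)} with hUw
    have hUw𝒜 : ∀ ω, Uw ω ∈ 𝒜 := fun ω ↦ ⟨hfinY ω i _, fun u hu ↦ by
      obtain ⟨k, -, rfl⟩ := (hY ω i u).1 hu.1; exact ⟨k, rfl⟩⟩
    have hB : {p : Ω × T | ∀ u' ∈ (X p.2).F i, u'.range ⊆ ball (0 : ℂ) (1 / ε) → ∃ u ∈ (Y p.1).F i, u'.udist u ≤ ε}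
        = ⋃ A ∈ 𝒜, {ω | Uw ω = A} ×ˢ
            {t | ∀ u' ∈ (X t).F i, u'.range ⊆ ball (0 : ℂ) (1 / ε) → ∃ u ∈ A, u'.udist u ≤ ε} := by
      ext p
      simp only [mem_setOf_eq, mem_iUnion, mem_prod, exists_prop]
      constructor
      · intro h
        refine ⟨Uw p.1, hUw𝒜 p.1, rfl, fun u' hu' hr ↦ ?_⟩
        obtain ⟨u, hu, hd⟩ := h u' hu' hr
        exact ⟨u, ⟨hu, UnbasedLoop.range_subset_ball_of_udist_le hr hd⟩, hd⟩
      · rintro ⟨A, -, hA, h⟩ u' hu' hr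
        obtain ⟨u, hu, hd⟩ := h u' hu' hr
        rw [← hA] at hu
        exact ⟨u, hu.1, hd⟩
    rw [hB]
    refine MeasurableSet.biUnion h𝒜c fun A hA ↦ MeasurableSet.prod ?_ ?_
    · -- `{ω | Uw ω = A}` is measurable
      have hset : {ω | Uw ω = A} =
          (⋂ u ∈ A, ({ω | u ∈ (Y ω).F i} ∩ {_ω : Ω | u.range ⊆ ball (0 : ℂ) (1 / ε + ε)})) ∩
          ⋂ k : ι, (((S i k)ᶜ ∪ {_ω : Ω | ¬ (f i k).range ⊆ ball (0 : ℂ) (1 / ε + ε)}) ∪ {_ω : Ω | f i k ∈ A}) := by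
        ext ω
        simp only [mem_setOf_eq, mem_inter_iff, mem_iInter, mem_union, mem_compl_iff]
        constructor
        · intro h
          refine ⟨fun u hu ↦ ?_, fun k ↦ ?_⟩
          · rw [← h] at hu; exact hu
          · by_cases hk : ω ∈ S i k
            · by_cases hr : (f i k).range ⊆ ball (0 : ℂ) (1 / ε + ε)
              · refine Or.inr ?_
                rw [← h]
                exact ⟨(hY ω i _).2 ⟨k, hk, rfl⟩, hr⟩
              · exact Or.inl (Or.inr hr)
            · exact Or.inl (Or.inl hk)
        · rintro ⟨hAU, hUA⟩
          ext u
          constructor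
          · rintro ⟨hu, hr⟩
            obtain ⟨k, hk, rfl⟩ := (hY ω i u).1 hu
            rcases hUA k with (hk' | hr') | h'
            · exact absurd hk hk'
            · exact absurd hr hr'
            · exact h'
          · exact fun hu ↦ hAU u hu
      rw [hset]
      exact (MeasurableSet.biInter hA.1.countable fun u _ ↦ (hmem i u).inter (measurableSet_setOf_const _)).inter
        (MeasurableSet.iInter fun k ↦ ((hS i k).compl.union (measurableSet_setOf_const _)).union
          (measurableSet_setOf_const _))
    · -- the `T`-part is the complement of the hitting event of an open set
      set V : Set (UnbasedLoop ℂ) :=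
        {v : UnbasedLoop ℂ | v.range ⊆ ball (0 : ℂ) (1 / ε)} ∩ ⋂ u ∈ A, {v : UnbasedLoop ℂ | ε < v.udist u} with hV
      have hVo : IsOpen V := (isOpen_setOf_unbased_range_subset isOpen_ball).inter
        (hA.1.isOpen_biInter fun u _ ↦ isOpen_lt continuous_const (continuous_udist_left u))
      have hset : {t | ∀ u' ∈ (X t).F i, u'.range ⊆ ball (0 : ℂ) (1 / ε) → ∃ u ∈ A, u'.udist u ≤ ε} =
          {t | ∃ u' ∈ (X t).F i, u' ∈ V}ᶜ := by
        ext t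
        simp only [hV, mem_setOf_eq, mem_compl_iff, mem_inter_iff, mem_iInter, not_exists, not_and, not_forall,
          not_lt, exists_prop]
      rw [hset]
      exact (measurableSet_hit_of_isOpen hX i hVo).compl

end SoftMachine

/-! ### The two lattice ensembles -/

/-- **Registered anchor** (`softMachine_measurableSet_isClose_latticeEnsembles`): for both lattice ensembles at every
mesh `δ > 0`, every `ε`, and every random configuration `X` on a measurable space with measurable hitting events of
closed sets of unbased loops, the closeness event `{(ω, t) | d_CN(E'.X δ ω, X t) ≤ ε}` is measurable. -/
theorem softMachine_measurableSet_isClose_latticeEnsembles : ∀ E' ∈ latticeEnsembles, ∀ (δ ε : ℝ), 0 < δ →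
    ∀ (T : Type) [MeasurableSpace T] (X : T → LoopConfig ℂ),
    (∀ (i : Fin 2) (Q : Set (UnbasedLoop ℂ)), IsClosed Q → MeasurableSet {t | ∃ u ∈ (X t).F i, u ∈ Q}) →
    MeasurableSet {p : E'.Ω × T | LoopConfig.IsClose ε (E'.X δ p.1) (X p.2)} := by
  intro E' hE' δ ε hδ T _ X hX
  simp only [latticeEnsembles, Set.mem_insert_iff, Set.mem_singleton_iff] at hE'
  rcases hE' with rfl | rfl
  · -- bond-`ℤ²`
    refine SoftMachine.measurableSet_isClose_of_hit (ι := {γ : List MedialVertex // γ ≠ []})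
      (fun ω ↦ bondLoopConfig δ 0 ω) X _ _
      (fun i k ↦ measurableSet_setOf_isInterfaceLoop_and k.1 i) (gen_bondLoopConfig δ 0) ?_ hX ε
    intro ω i R
    refine (ncard_loops_meeting_le hδ R ω).1.subset ?_
    rintro u ⟨hu, hr⟩
    refine ⟨?_, ?_⟩
    · fin_cases i
      · exact Or.inl hu
      · exact Or.inr hu
    · obtain ⟨x, hx⟩ := u.range_nonempty
      exact ⟨x, hx, ball_subset_closedBall (hr hx)⟩
  · -- site-`𝕋`
    haveI := countable_sigma_hexLoop
    refine SoftMachine.measurableSet_isClose_of_hit (ι := Σ v : HexVertex, hexGraph.Walk v v)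
      (fun ω ↦ siteLoopConfig δ ω) X _ _
      (fun i k ↦ measurableSet_gen_siteLoopConfig i k) (gen_siteLoopConfig δ) ?_ hX ε
    intro ω i R
    refine (ncard_loops_siteLoopConfig_meeting_le hδ R ω).1.subset ?_
    rintro u ⟨hu, hr⟩
    refine ⟨LoopConfig.subset_loops _ i hu, ?_⟩
    obtain ⟨x, hx⟩ := u.range_nonempty
    exact ⟨x, hx, ball_subset_closedBall (hr hx)⟩

end Summit.CriticalPhenomena.CardyFormulaZ2.Cruxes.NestingRigidity.PositiveConeWeightDoubling

end
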